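/-
Copyright (c) 2026. All rights reserved.
Released under Apache 2.0 license as described in the file LICENSE.
Authors: abc-iut cell — seat abc-iut-w5-d225 (wave 5; §4(iii) non-vacuity programme, L4 rows of
abc-iut-w5-d243's INTERFACE-NV-CENSUS: `CuspidalData`, `MLFBase`, `NFBase`, `CurveModel`).
-/
import Literature.AnabelianGeometry.AbsoluteAnabelian.AbsAnabFundamentalGroups
import Literature.AnabelianGeometry.AbsoluteAnabelian.AbsTopIII.CurveModel
import HarnessLib

/-!
# Non-vacuity records for four [AbsTopIII] §1 / [AbsAnab] §1.1 interfaces: `CuspidalData`, `MLFBase`, `NFBase`, `CurveModel`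

S. Mochizuki, *Topics in absolute anabelian geometry III* [MochizukiAbsTopIII2015], Prop 1.4 (i) p. 31 (cuspidal
decomposition / inertia groups), Thm 1.9 p. 37 (`G_k := Gal(k̄/k)`); *The absolute anabelian geometry of hyperbolic
curves* [MochizukiAbsAnab2004] §1.1 p. 7, §1.3 p. 18 ("`G = G_F` or `G_𝔭`").

abc-iut-w5-d243's INTERFACE-NV-CENSUS (HOME/staging/w5/w5-d243/INTERFACE-NV-CENSUS.md, 03:03Z) lists the layer-L4
interfaces `FundamentalExtension.CuspidalData` (19 consumer files), `FundamentalExtension.MLFBase` (21),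
`FundamentalExtension.NFBase` (5) and `CurveModel` (28) with ZERO kernel inhabitants: every theorem quantified
over them is, today, uninstantiated.  This PROOF-ONLY file (no `def`/`instance`/`structure`; witnesses built
inside the theorem terms) records, with honest labels:

* `FundamentalExtension.CuspidalData.nonempty_cuspless` — over EVERY extension `E`: the cuspidal data with NO
  cusps (genuine for a PROPER curve `U = X`: "the points of `X ∖ U`" is empty);
* `FundamentalExtension.CuspidalData.nonempty_single` — over every `E`, one cusp with any CLOSED subgroup as its
  decomposition group (`I := D ∩ Δ`; `eq_of_conj` is trivial with one cusp) — honest label: a single-cusp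
  consistency witness, not a cuspidal decomposition group of a curve;
* `FundamentalExtension.MLFBase.nonempty_of_equiv` / `NFBase.nonempty_of_equiv` — packaging: any
  `E.gal ≃ₜ* G_K` (`K/ℚ_p` finite) resp. `E.gal ≃ₜ* G_F` (`F` a number field) inhabits the record; and the
  DEGENERATE closed instances `exists_nonempty_mlfBase_degenerate` / `exists_nonempty_nfBase_degenerate` at the
  "point" extension `Π = G = G_{ℚ_p}` resp. `G_ℚ`, `Δ = 1` (label «degenerate»: no hyperbolic curve has `Δ = 1`;
  the BASE-FIELD package is genuine — `ℚ_p` / `ℚ` with Mathlib's absolute Galois group);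
* `AbsTopIII.CurveModel.nonempty_degenerate` — the one-object index category over `ℚ` with the point extension, no cusps,
  function field `ℚ`, genus `0`, `res := 𝟙`.  OBSERVATION recorded by this witness: `CurveModel` carries NO
  axiom — its seven `Prop`-valued fields (`IsProper`, `IsScheme`, `IsNFCurve`, `IsNFPoint`, `IsNFRational`,
  `IsNFConstant`, `IsStrictlyBelyiType`, and `IsCofiniteOpen`) are predicate-valued DATA; all comparison facts of
  [AbsTopIII] §1 are separate predicates ON a `CurveModel` (as its docstring says), so inhabitation is trivial and
  the substantive non-vacuity questions live in those predicates, not in the record.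

HONEST FRAMING: consistency / packaging facts about the cell's own interface records; nothing of [AbsTopIII] is
asserted; a genuine inhabitant (étale `π₁` of a hyperbolic curve) is not available in Mathlib; nothing here bears
on the disputed [IUTchIII] Cor. 3.12.
-/

namespace Literature.AnabelianGeometry.AbsoluteAnabelian

open CategoryTheory Field

universe u

namespace FundamentalExtension

variable (E : FundamentalExtension.{u})

/-- **Cuspidal data with no cusps** (the proper case `U = X`): inhabited over every extension.
[cite: MochizukiAbsTopIII2015, Prop 1.4 (i) p.31] -/
theorem CuspidalData.nonempty_cuspless : Nonempty E.CuspidalData :=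
  ⟨{ Cusp := PEmpty.{u + 1}
     Dcusp := fun x => x.elim
     Icusp := fun x => x.elim
     Icusp_eq := fun x => x.elim
     isClosed_Dcusp := fun x => x.elim
     eq_of_conj := fun x => x.elim }⟩

/-- **Single-cusp consistency witness**: over every extension, ONE cusp with an arbitrary closed subgroup `D ⊆ Π`
as decomposition group and `I := D ∩ Δ` (honest label: not the decomposition group of a cusp of a curve — a
joint-satisfiability witness of the record's three axioms). [cite: MochizukiAbsTopIII2015, Prop 1.4 (i) p.31] -/
theorem CuspidalData.nonempty_single (D : Subgroup E.arith) (hD : IsClosed (D : Set E.arith)) :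
    ∃ C : E.CuspidalData, Nonempty (C.Cusp ≃ PUnit.{u + 1}) ∧ ∀ x, C.Dcusp x = D :=
  ⟨{ Cusp := PUnit.{u + 1}
     Dcusp := fun _ => D
     Icusp := fun _ => D ⊓ E.geom
     Icusp_eq := fun _ => rfl
     isClosed_Dcusp := fun _ => hD
     eq_of_conj := fun x y _ _ => Subsingleton.elim x y }, ⟨Equiv.refl _⟩, fun _ => rfl⟩

/-- **`MLFBase` packaging**: an identification `G ≅ G_K` with `K` a finite extension of `ℚ_p` inhabits the record
"the base field is the MLF `K`". [cite: MochizukiAbsAnab2004, §1.3 p.18] -/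
theorem MLFBase.nonempty_of_equiv {p : ℕ} [Fact p.Prime] (K : Type u) [Field K] [Algebra ℚ_[p] K]
    [FiniteDimensional ℚ_[p] K] (e : E.gal ≃ₜ* absoluteGaloisGroup K) : Nonempty E.MLFBase :=
  ⟨{ p := p, K := K, galIso := e }⟩

/-- **`NFBase` packaging**: an identification `G ≅ G_F` with `F` a number field inhabits the record "the base field
is the number field `F`". [cite: MochizukiAbsAnab2004, §1.1 p.7] -/
theorem NFBase.nonempty_of_equiv (F : Type u) [Field F] [NumberField F] (e : E.gal ≃ₜ* absoluteGaloisGroup F) :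
    Nonempty E.NFBase :=
  ⟨{ F := F, galIso := e }⟩

end FundamentalExtension

/-- **Closed DEGENERATE instance of `MLFBase`**: the "point" extension `Π = G = G_{ℚ_p}` (`Δ = 1`; no hyperbolic
curve has trivial `Δ` — the base-field package is the genuine `ℚ_p` with Mathlib's absolute Galois group).
[cite: MochizukiAbsAnab2004, §1.3 p.18] -/
theorem FundamentalExtension.exists_nonempty_mlfBase_degenerate (p : ℕ) [Fact p.Prime] :
    ∃ E : FundamentalExtension.{0}, E.geom = ⊥ ∧ Nonempty E.MLFBase := by
  refine ⟨{ arith := absoluteGaloisGrp ℚ_[p], gal := absoluteGaloisGrp ℚ_[p], aug := ContinuousMonoidHom.id _,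
            aug_surjective := Function.surjective_id }, ?_, ?_⟩
  · exact (MonoidHom.ker_eq_bot_iff _).mpr Function.injective_id
  · exact FundamentalExtension.MLFBase.nonempty_of_equiv (p := p) _ ℚ_[p] (ContinuousMulEquiv.refl _)

/-- **Closed DEGENERATE instance of `NFBase`**: the "point" extension `Π = G = G_ℚ` (`Δ = 1`).
[cite: MochizukiAbsAnab2004, §1.1 p.7] -/
theorem FundamentalExtension.exists_nonempty_nfBase_degenerate :
    ∃ E : FundamentalExtension.{0}, E.geom = ⊥ ∧ Nonempty E.NFBase := by
  refine ⟨{ arith := absoluteGaloisGrp ℚ, gal := absoluteGaloisGrp ℚ, aug := ContinuousMonoidHom.id _,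
            aug_surjective := Function.surjective_id }, ?_, ?_⟩
  · exact (MonoidHom.ker_eq_bot_iff _).mpr Function.injective_id
  · exact FundamentalExtension.NFBase.nonempty_of_equiv _ ℚ (ContinuousMulEquiv.refl _)

/-- **`CurveModel` is inhabited (DEGENERATE one-object toy)** — and carries no axiom: its `Prop`-valued fields are
predicate-valued data.  Index category: one object over `k := ℚ`, the point extension `Π = G_ℚ`, no cusps,
function field `ℚ`, genus `0`, every predicate `False` except `IsCofiniteOpen := (· = ·)` with `res := 𝟙`.
[cite: MochizukiAbsTopIII2015, Prop 1.4 p.31] -/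
theorem AbsTopIII.CurveModel.nonempty_degenerate : Nonempty AbsTopIII.CurveModel.{0} := by
  let E₀ : FundamentalExtension.{0} :=
    { arith := absoluteGaloisGrp ℚ, gal := absoluteGaloisGrp ℚ, aug := ContinuousMonoidHom.id _,
      aug_surjective := Function.surjective_id }
  obtain ⟨C₀⟩ := FundamentalExtension.CuspidalData.nonempty_cuspless E₀
  exact ⟨{ Curve := PUnit.{2}
           base := fun _ => ℚ
           ext := fun _ => E₀
           galIso := fun _ => Iso.refl _
           cusps := fun _ => C₀
           IsProper := fun _ => True
           IsScheme := fun _ => True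
           genus := fun _ => 0
           FunctionField := fun _ => ℚ
           Point := fun _ => PEmpty.{1}
           decomp := fun _ x => x.elim
           IsNFCurve := fun _ => False
           IsNFPoint := fun _ x => x.elim
           IsNFRational := fun _ _ => False
           IsNFConstant := fun _ _ => False
           NFFunctionField := fun _ => ℚ
           IsStrictlyBelyiType := fun _ => False
           IsCofiniteOpen := fun U U' => U = U'
           res := fun {U U'} _ => 𝟙 E₀ }⟩

end Literature.AnabelianGeometry.AbsoluteAnabelian
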